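import Summits.HodgeConjecture.HodgeConjecture.Theorems.H413TowerConj
import Summits.HodgeConjecture.HodgeConjecture.Theorems.H413CohFormsHodgeTypesDisjoint
import Mathlib.LinearAlgebra.Projection
import HarnessLib

/-!
# FLOOR-0 P2 ∕ P3 ∕ P4 — the MATSUSHIMA–HODGE REALISATION of the tower `H = colim_K H¹(X_K(ℂ); ℂ)` by `(1,0) ⊕ (0,1)` cotangent forms:
# ASSEMBLY from a levelwise holomorphic realisation system (Hodge split of the level carriers + direct limit)

Cell hodgecm-mathlib (D-0151), FLOOR 0, crux item H413 = stmt-HodgeConjecture-24833.  Author F0P2-p04 (g0) (wave 2, programme P2, seat U1′;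
joint desk with P3-S1 ∕ P4-T2′: bus `F0/P2/STATUS.md` 2026-08-30T21:5xZ).  `--supports stmt-HodgeConjecture-24833 --as helper`.
HC_CM is proved only modulo the 7 printed citations until rung 0 closes; this file proves nothing about them.

THE STUBS SERVED.  P2's `StubU1RealisationAt` (`Cruxes/H413/Lines/P2ThetaDictionaryExists.lean`) and P3's `StubS1HodgeMatsushimaDecAt`
(`Cruxes/H413/Lines/F0_U3CohMultOne.lean`) both ask for an INJECTIVE `ℂ`-linear map out of the pin's `H¹_{B,τ'}(A_∞, ℂ)` (= binder-1's tower
`Tower … V`, `Model/TowerCarrier`) into the `ℂ²`-valued functions on `U(V)(𝔸_{F⁺})`, `U(V)(𝔸_{F⁺,f})`-equivariant (`rhoB τ' = act` versus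
`rightRep F V`) and valued in the cohomological cotangent forms `cohForms 𝔞₀ = holCotForms 𝔞₀ ⊔ conj (holCotForms 𝔞₀)` of the factor of record
`𝔞₀ = archFactorOf F V` (★ `Theorems/H413CohFormsCarriers`) — the INVERSE direction of P4's class map `clsHol` (★ `Theorems/H413CuspCot*`).

THIS FILE = the level-independent half of that construction, GENERIC over the levelwise holomorphic input.  A **levelwise holomorphic realisation
system** is a family of `ℂ`-linear maps `ρ Γ hΓ : H10L Γ hΓ →ₗ[ℂ] (U(V)(𝔸_{F⁺}) → ℂ²)` on the `(1,0)`-families of every level `Γ` (★ `TowerConj.H10L`: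
families in binder-1's `towerLevel Γ hΓ` all of whose components lie in `F¹H¹(X_{Γ^h}; ℂ)`) subject to
(R1) compatibility with the change of level `restrictLevel` (pull-back along the component coverings does not change the function),
(R2) compatibility with the re-indexing `translate g` versus the finite-adelic right translation `rightRep F V g`,
(R3) values in `holCotForms 𝔞₀`, (R4) injectivity.  (The intended instance — `ρ a (x) = (pinD … (Γ.conj x_f)).pull (a x_f) (x_{ι₁})`, the harmonic
pull-back of the component class of index `x_f` read at the `U(2,1)`-coordinate of `x` — is the GLUE file of the joint desk; nothing here depends on it.)
From such a system:
* §0–§1 the `(1,0)`-PROJECTION `π_Δ` of `H¹(X_Δ; ℂ) = F¹ ⊕ conj F¹` (weight-one opposedness ★ `HodgeStructure.isCompl_F_complexConj 1 1`, Mathlib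
  `Submodule.projection`); it commutes with the rational translates `t_γ^*` (they preserve `F¹`, ★ `TowerConj.trPull_mem_F`, and commute with
  `conj`, ★ `TowerConj.conj_trPull`), hence acts componentwise on `towerLevel Γ hΓ` (`projL`), commuting with `restrictLevel` and `translate`;
  the HODGE DECOMPOSITION OF A FAMILY `c = π c + conj (π (conj c))` (`eq_projL_add_conjL_projL_conjL`);
* §2 the LEVEL REALISATION `realL ρ Γ hΓ c := ρ (π c) + conjFun (ρ (π (conj c)))` — `ℂ`-linear (conjugate-linear ∘ linear ∘ conjugate-linear) —
  and, over (R1), THE REALISATION OF THE TOWER `realT ρ : Tower … V →ₗ[ℂ] (U(V)(𝔸_{F⁺}) → ℂ²)` by `Module.DirectLimit.lift` (`realT_ofLevel`);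
* §3 over (R3): values in `cohForms 𝔞₀`; over (R2): `realT (act g x) = rightRep g (realT x)` (★ `conjFun_rightRep`, ★ `TowerConj.translate_conjL`);
  over (R3)+(R4): `realT` is INJECTIVE — the two summands live in the DISJOINT Hodge types ★ `disjoint_holCotForms_map_conjFun` (A-p09), so both
  vanish, so `π c = π (conj c) = 0`, so `c = 0` by the Hodge decomposition of the family; no injectivity of the transition maps is used;
* §4 the packaged statement `exists_realisation_of_system` (injective, `cohForms`-valued, `towerRep`-equivariant).

[cite: VoisinHodgeI2002, §6.1.3 Prop. 6.11 and Cor. 6.12; §7.1.1 Cor. 7.6] [cite: BorelWallach2000, VII 2.10, VII 3.2, XIII 1.2] [cite: DeligneHodgeII1971, 1.2.5 and 2.1.4]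

## References
* [VoisinHodgeI2002] C. Voisin, *Hodge Theory and Complex Algebraic Geometry I*, CUP 2002, §6.1.3 (`H¹ = H^{1,0} ⊕ H^{0,1}`, `H^{0,1} = conj H^{1,0}`), §7.1.1 Cor. 7.6.
* [BorelWallach2000] A. Borel, N. Wallach, 2nd ed., AMS 2000, VII 2.10 (Hodge bigrading), VII 3.2 (Matsushima), XIII 1.2 (adelic pieces).
* [DeligneHodgeII1971] P. Deligne, *Théorie de Hodge II*, 1.2.5 (opposed filtrations), 2.1.4 (`conj ⊗ id`).
* Tree: HodgeCM `Model/TowerLevel_1`, `_2`, `Model/TowerCarrier` (binder-1), ★ `Theorems/H413TowerConj` (A-p19: `conjL`, `H10L`, `conj_trPull`,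
  `trPull_mem_F`, `restrictLevel_conjL`, `translate_conjL`), ★ `Theorems/H413CohFormsCarriers` (`rightRep`, `conjFun`, `holCotForms`, `cohForms`,
  `archFactorOf`), ★ `Theorems/H413CohFormsCarriersLemmas` (`conjFun_rightRep`, `conjFun_conjFun`), ★ `Theorems/H413CohFormsHodgeTypesDisjoint`
  (`disjoint_holCotForms_map_conjFun`), `Literature/AlgebraicGeometry/Motives/HodgeStructure` (`conj`, `complexConj`, `isCompl_F_complexConj`),
  Mathlib `LinearAlgebra/Projection` (`Submodule.projection`), `Algebra/Colimit/Module` (`Module.DirectLimit.lift`).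
-/

set_option autoImplicit false
set_option linter.dupNamespace false

noncomputable section

open Function Set
open Literature.AlgebraicGeometry.Motives
open Literature.AlgebraicGeometry.ShimuraVarieties
open Literature.AlgebraicGeometry.HodgeTheory
open Literature.NumberTheory.Automorphic
open Literature.NumberTheory.Automorphic.PicardCM
open Literature.NumberTheory.Transcendental (Arapura2012_Cor_15_4_6)
open HodgeCM HodgeCM.Model HodgeCM.Model.LevelTranslate HodgeCM.Model.TowerLevel HodgeCM.Model.TowerCarrier
open Summit.HodgeConjecture.HodgeConjecture.Cruxes.H413.CohFormsCarriers
open Summit.HodgeConjecture.HodgeConjecture.Cruxes.H413.TowerConj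

namespace Summit.HodgeConjecture.HodgeConjecture.Cruxes.H413.TowerRealisation

/-! ## §0 A projection commutes with the linear maps preserving both summands -/

/-- **A projection commutes with every linear map preserving both complementary summands**: if `T(p) ⊆ p'` and `T(q) ⊆ q'` then
`π_{p'} (T x) = T (π_p x)`. [folklore] -/
theorem projection_map_comm {R E E' : Type*} [Ring R] [AddCommGroup E] [Module R E] [AddCommGroup E'] [Module R E']
    {p q : Submodule R E} {p' q' : Submodule R E'} (h : IsCompl p q) (h' : IsCompl p' q') (T : E →ₗ[R] E')
    (hp : ∀ x ∈ p, T x ∈ p') (hq : ∀ x ∈ q, T x ∈ q') (x : E) :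
    p'.projection q' h' (T x) = T (p.projection q h x) := by
  have hx : T x = T (p.projection q h x) + T (x - p.projection q h x) := by
    rw [← map_add, add_sub_cancel]
  rw [hx, map_add, Submodule.projection_apply_of_mem_left h' (hp _ (Submodule.projection_apply_mem h x)),
    Submodule.projection_apply_of_mem_right h' (hq _ (Submodule.sub_projection_mem h x)), add_zero]

variable (hHD : exists_isReal_hodgeModel) (hI : hodgePQ_independent_of_hodgeModel)
  (hU : BallQuotientUniformisedDatum) (h₃ : CMAbelianVarietyRealised) (hA : Arapura2012_Cor_15_4_6)
variable {L : CMField} {ι₁ : L →+* ℂ} {V : HermSpace3 L ι₁}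

/-! ## §1 The `(1,0)`-projection of `H¹(X_Δ; ℂ)` and of the level carriers -/

/-- `F¹H¹(X_Δ(ℂ); ℂ)` — the first step of the Hodge filtration of the model universe's Hodge structure on `H¹` of the surface `P_Δ`.
[cite: VoisinHodgeI2002, §7.1.1 Cor. 7.6] -/
abbrev F1 (Δ : Level V) : Submodule ℂ (Coh hHD hI hU h₃ Δ 1) :=
  ((universeOf hHD hI hU h₃).hodge ((universeOf hHD hI hU h₃).pms L ι₁ V Δ) 1).F 1

/-- **Weight-one Hodge decomposition `H¹(X_Δ; ℂ) = F¹ ⊕ conj F¹`** (`F¹` and `conj F¹` are `1`-opposed). [cite: DeligneHodgeII1971, 1.2.5]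
[cite: VoisinHodgeI2002, §6.1.3 Cor. 6.12] -/
theorem isCompl_F1 (Δ : Level V) :
    IsCompl (F1 hHD hI hU h₃ Δ) (HodgeStructure.complexConj (F1 hHD hI hU h₃ Δ)) :=
  ((universeOf hHD hI hU h₃).hodge ((universeOf hHD hI hU h₃).pms L ι₁ V Δ) 1).isCompl_F_complexConj 1 1 (by norm_num)

/-- **The `(1,0)`-projection `π_Δ : H¹(X_Δ; ℂ) → H¹(X_Δ; ℂ)`** onto `F¹` along `conj F¹`. [cite: VoisinHodgeI2002, §6.1.3 Cor. 6.12] -/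
abbrev proj10 (Δ : Level V) : Coh hHD hI hU h₃ Δ 1 →ₗ[ℂ] Coh hHD hI hU h₃ Δ 1 :=
  (F1 hHD hI hU h₃ Δ).projection (HodgeStructure.complexConj (F1 hHD hI hU h₃ Δ)) (isCompl_F1 hHD hI hU h₃ Δ)

/-- `π_Δ x ∈ F¹`. [cite: VoisinHodgeI2002, §6.1.3] -/
theorem proj10_mem (Δ : Level V) (x : Coh hHD hI hU h₃ Δ 1) : proj10 hHD hI hU h₃ Δ x ∈ F1 hHD hI hU h₃ Δ :=
  Submodule.projection_apply_mem _ x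

/-- `x - π_Δ x ∈ conj F¹`. [cite: VoisinHodgeI2002, §6.1.3] -/
theorem sub_proj10_mem (Δ : Level V) (x : Coh hHD hI hU h₃ Δ 1) :
    x - proj10 hHD hI hU h₃ Δ x ∈ HodgeStructure.complexConj (F1 hHD hI hU h₃ Δ) :=
  Submodule.sub_projection_mem _ x

/-- `π_Δ` is the identity on `F¹`. [cite: VoisinHodgeI2002, §6.1.3] -/
theorem proj10_eq_self (Δ : Level V) {x : Coh hHD hI hU h₃ Δ 1} (hx : x ∈ F1 hHD hI hU h₃ Δ) : proj10 hHD hI hU h₃ Δ x = x :=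
  Submodule.projection_apply_of_mem_left _ hx

/-- `π_Δ` kills `conj F¹`. [cite: VoisinHodgeI2002, §6.1.3] -/
theorem proj10_eq_zero (Δ : Level V) {x : Coh hHD hI hU h₃ Δ 1} (hx : x ∈ HodgeStructure.complexConj (F1 hHD hI hU h₃ Δ)) :
    proj10 hHD hI hU h₃ Δ x = 0 :=
  Submodule.projection_apply_of_mem_right _ hx

/-- **`π (conj x) = conj (x - π x)`** — the `(1,0)`-part of the conjugate class is the conjugate of the `(0,1)`-part. [cite: VoisinHodgeI2002, §6.1.3 Cor. 6.12] -/
theorem proj10_conj (Δ : Level V) (x : Coh hHD hI hU h₃ Δ 1) :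
    proj10 hHD hI hU h₃ Δ (HodgeStructure.conj x) = HodgeStructure.conj (x - proj10 hHD hI hU h₃ Δ x) := by
  have hx : HodgeStructure.conj x =
      HodgeStructure.conj (proj10 hHD hI hU h₃ Δ x) + HodgeStructure.conj (x - proj10 hHD hI hU h₃ Δ x) := by
    rw [← map_add, add_sub_cancel]
  rw [hx, map_add, proj10_eq_zero hHD hI hU h₃ Δ, zero_add, proj10_eq_self hHD hI hU h₃ Δ]
  · exact HodgeStructure.mem_complexConj.mp (sub_proj10_mem hHD hI hU h₃ Δ x)
  · rw [HodgeStructure.mem_complexConj, HodgeStructure.conj_conj]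
    exact proj10_mem hHD hI hU h₃ Δ x

/-- **`π` commutes with the rational translates `t_γ^*`** (they preserve `F¹` and, commuting with `conj`, also `conj F¹`). [cite: VoisinHodgeI2002, §7.1.1]
[cite: DeligneHodgeII1971, 2.1.4] -/
theorem proj10_trPull (γ : ↥(Urat V)) (Δ₁ Δ₂ : Level V) (ht : TransCond (γ : GL (Fin 3) L) Δ₁ Δ₂) (x : Coh hHD hI hU h₃ Δ₂ 1) :
    proj10 hHD hI hU h₃ Δ₁ (trPull hHD hI hU h₃ hA γ Δ₁ Δ₂ ht 1 x) = trPull hHD hI hU h₃ hA γ Δ₁ Δ₂ ht 1 (proj10 hHD hI hU h₃ Δ₂ x) :=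
  projection_map_comm _ _ (trPull hHD hI hU h₃ hA γ Δ₁ Δ₂ ht 1) (fun _ hy => trPull_mem_F hHD hI hU h₃ hA γ Δ₁ Δ₂ ht 1 hy)
    (fun y hy => by
      rw [HodgeStructure.mem_complexConj] at hy ⊢
      rw [conj_trPull]
      exact trPull_mem_F hHD hI hU h₃ hA γ Δ₁ Δ₂ ht 1 hy) x

section Level

variable (Γ : Level V) (hΓ : Γ.BelowConjThree)

/-- **The componentwise `(1,0)`-projection of the level carrier `H_K`**: `(π c) h = π_{Γ^h} (c h)`; it preserves the defining translation identities of
`towerLevel` (`proj10_trPull`). [cite: BorelWallach2000, VII 2.10] [cite: VoisinHodgeI2002, §6.1.3] -/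
def projL : towerLevel hHD hI hU h₃ hA Γ hΓ →ₗ[ℂ] towerLevel hHD hI hU h₃ hA Γ hΓ where
  toFun c := ⟨fun h ↦ proj10 hHD hI hU h₃ (Γ.conj h hΓ) ((c : Π h, W hHD hI hU h₃ Γ hΓ h) h),
    (mem_towerLevel_iff hHD hI hU h₃ hA).mpr fun γ h h' r ↦ by
      show proj10 hHD hI hU h₃ (Γ.conj h hΓ) ((c : Π h, W hHD hI hU h₃ Γ hΓ h) h) =
        trPull hHD hI hU h₃ hA γ _ _ (transCond_of_rel hΓ r) 1 (proj10 hHD hI hU h₃ (Γ.conj h' hΓ) ((c : Π h, W hHD hI hU h₃ Γ hΓ h) h'))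
      rw [apply_eq_trPull hHD hI hU h₃ hA c r (transCond_of_rel hΓ r), proj10_trPull]⟩
  map_add' c d := by
    ext h
    simp only [Submodule.coe_add, Pi.add_apply, map_add]
  map_smul' a c := by
    ext h
    simp only [Submodule.coe_smul, Pi.smul_apply, map_smul, RingHom.id_apply]

variable {Γ hΓ}

/-- Components of the projected family. [cite: VoisinHodgeI2002, §6.1.3] -/
@[simp] theorem projL_apply (c : towerLevel hHD hI hU h₃ hA Γ hΓ) (h : V.adelicFin) :
    (projL hHD hI hU h₃ hA Γ hΓ c : Π h, W hHD hI hU h₃ Γ hΓ h) h =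
      proj10 hHD hI hU h₃ (Γ.conj h hΓ) ((c : Π h, W hHD hI hU h₃ Γ hΓ h) h) := rfl

/-- `π c` is a `(1,0)`-family. [cite: VoisinHodgeI2002, §6.1.3] -/
theorem projL_mem_H10L (c : towerLevel hHD hI hU h₃ hA Γ hΓ) : projL hHD hI hU h₃ hA Γ hΓ c ∈ H10L hHD hI hU h₃ hA Γ hΓ :=
  (mem_H10L_iff hHD hI hU h₃ hA _).mpr fun _ ↦ proj10_mem hHD hI hU h₃ _ _

/-- `π` is the identity on `(1,0)`-families. [cite: VoisinHodgeI2002, §6.1.3] -/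
theorem projL_eq_self_of_mem {c : towerLevel hHD hI hU h₃ hA Γ hΓ} (hc : c ∈ H10L hHD hI hU h₃ hA Γ hΓ) :
    projL hHD hI hU h₃ hA Γ hΓ c = c := by
  apply Subtype.ext; funext h
  rw [projL_apply]
  exact proj10_eq_self hHD hI hU h₃ _ ((mem_H10L_iff hHD hI hU h₃ hA c).mp hc h)

/-- `π` kills the conjugates of `(1,0)`-families. [cite: VoisinHodgeI2002, §6.1.3] -/
theorem projL_conjL_eq_zero_of_mem {c : towerLevel hHD hI hU h₃ hA Γ hΓ} (hc : c ∈ H10L hHD hI hU h₃ hA Γ hΓ) :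
    projL hHD hI hU h₃ hA Γ hΓ (conjL hHD hI hU h₃ hA Γ hΓ c) = 0 := by
  apply Subtype.ext; funext h
  rw [projL_apply, conjL_apply, Submodule.coe_zero, Pi.zero_apply]
  refine proj10_eq_zero hHD hI hU h₃ _ ?_
  rw [HodgeStructure.mem_complexConj, HodgeStructure.conj_conj]
  exact (mem_H10L_iff hHD hI hU h₃ hA c).mp hc h

/-- **THE HODGE DECOMPOSITION OF A FAMILY: `c = π c + conj (π (conj c))`**, both `π c` and `π (conj c)` being `(1,0)`-families.
[cite: VoisinHodgeI2002, §6.1.3 Cor. 6.12] [cite: BorelWallach2000, VII 2.10] -/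
theorem eq_projL_add_conjL_projL_conjL (c : towerLevel hHD hI hU h₃ hA Γ hΓ) :
    c = projL hHD hI hU h₃ hA Γ hΓ c + conjL hHD hI hU h₃ hA Γ hΓ (projL hHD hI hU h₃ hA Γ hΓ (conjL hHD hI hU h₃ hA Γ hΓ c)) := by
  apply Subtype.ext; funext h
  rw [Submodule.coe_add, Pi.add_apply, conjL_apply, projL_apply, projL_apply, conjL_apply, proj10_conj, HodgeStructure.conj_conj,
    add_sub_cancel]

/-- `π` commutes with the change of level. [cite: BorelWallach2000, XIII 1.2] -/
theorem restrictLevel_projL {Γ Γ' : Level V} (hle : Γ' ≤ Γ) (hΓ : Γ.BelowConjThree) (hΓ' : Γ'.BelowConjThree)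
    (c : towerLevel hHD hI hU h₃ hA Γ hΓ) :
    restrictLevel hHD hI hU h₃ hA hle hΓ hΓ' (projL hHD hI hU h₃ hA Γ hΓ c) =
      projL hHD hI hU h₃ hA Γ' hΓ' (restrictLevel hHD hI hU h₃ hA hle hΓ hΓ' c) := by
  apply Subtype.ext; funext h
  simp only [restrictLevel_apply, projL_apply, proj10_trPull]

/-- `π` commutes with the re-indexing `translate g`. [cite: BorelWallach2000, XIII 1.2] -/
theorem translate_projL {Γ : Level V} (hΓ : Γ.BelowConjThree) (g : V.adelicFin) (c : towerLevel hHD hI hU h₃ hA Γ hΓ) :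
    translate hHD hI hU h₃ hA hΓ g (projL hHD hI hU h₃ hA Γ hΓ c) =
      projL hHD hI hU h₃ hA (Γ.conj g hΓ) (hΓ.conj g) (translate hHD hI hU h₃ hA hΓ g c) := by
  apply Subtype.ext; funext h
  simp only [translate_apply, projL_apply, proj10_trPull]

/-- `translate g` preserves `(1,0)`-families (`t_1^*` preserves `F¹`). [cite: VoisinHodgeI2002, §7.1.1] -/
theorem translate_mem_H10L {Γ : Level V} (hΓ : Γ.BelowConjThree) (g : V.adelicFin) {c : towerLevel hHD hI hU h₃ hA Γ hΓ}
    (hc : c ∈ H10L hHD hI hU h₃ hA Γ hΓ) :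
    translate hHD hI hU h₃ hA hΓ g c ∈ H10L hHD hI hU h₃ hA (Γ.conj g hΓ) (hΓ.conj g) := by
  rw [mem_H10L_iff] at hc ⊢
  intro h
  rw [translate_apply]
  exact trPull_mem_F hHD hI hU h₃ hA 1 _ _ _ 1 (hc _)

variable (Γ hΓ) in
/-- **The holomorphic part of a family**, as an element of the `(1,0)`-families `H10L Γ hΓ`. [cite: VoisinHodgeI2002, §6.1.3] -/
def holPart : towerLevel hHD hI hU h₃ hA Γ hΓ →ₗ[ℂ] ↥(H10L hHD hI hU h₃ hA Γ hΓ) :=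
  LinearMap.codRestrict (H10L hHD hI hU h₃ hA Γ hΓ) (projL hHD hI hU h₃ hA Γ hΓ) (projL_mem_H10L hHD hI hU h₃ hA)

/-- `holPart c = π c` as families. [cite: VoisinHodgeI2002, §6.1.3] -/
@[simp] theorem coe_holPart (c : towerLevel hHD hI hU h₃ hA Γ hΓ) :
    (holPart hHD hI hU h₃ hA Γ hΓ c : towerLevel hHD hI hU h₃ hA Γ hΓ) = projL hHD hI hU h₃ hA Γ hΓ c := rfl

/-- `holPart` commutes with the change of level. [cite: BorelWallach2000, XIII 1.2] -/
theorem holPart_restrictLevel {Γ Γ' : Level V} (hle : Γ' ≤ Γ) (hΓ : Γ.BelowConjThree) (hΓ' : Γ'.BelowConjThree)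
    (c : towerLevel hHD hI hU h₃ hA Γ hΓ) :
    holPart hHD hI hU h₃ hA Γ' hΓ' (restrictLevel hHD hI hU h₃ hA hle hΓ hΓ' c) =
      ⟨restrictLevel hHD hI hU h₃ hA hle hΓ hΓ' (holPart hHD hI hU h₃ hA Γ hΓ c),
        restrictLevel_mem_H10L hHD hI hU h₃ hA hle hΓ hΓ' (holPart hHD hI hU h₃ hA Γ hΓ c).2⟩ :=
  Subtype.ext (restrictLevel_projL hHD hI hU h₃ hA hle hΓ hΓ' c).symm

/-- `holPart` commutes with `translate g`. [cite: BorelWallach2000, XIII 1.2] -/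
theorem holPart_translate {Γ : Level V} (hΓ : Γ.BelowConjThree) (g : V.adelicFin) (c : towerLevel hHD hI hU h₃ hA Γ hΓ) :
    holPart hHD hI hU h₃ hA (Γ.conj g hΓ) (hΓ.conj g) (translate hHD hI hU h₃ hA hΓ g c) =
      ⟨translate hHD hI hU h₃ hA hΓ g (holPart hHD hI hU h₃ hA Γ hΓ c),
        translate_mem_H10L hHD hI hU h₃ hA hΓ g (holPart hHD hI hU h₃ hA Γ hΓ c).2⟩ :=
  Subtype.ext (translate_projL hHD hI hU h₃ hA hΓ g c).symm

end Level

/-! ## §2 Levelwise holomorphic realisation systems, the level realisation and the realisation of the tower -/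

section System

variable (ρ : ∀ (Γ : Level V) (hΓ : Γ.BelowConjThree),
  ↥(H10L hHD hI hU h₃ hA Γ hΓ) →ₗ[ℂ] ((adelicDatum L V).Adelic → (Fin 2 → ℂ)))

/-- **The level realisation** of a family `c ∈ H_K`: `ρ (π c) + conj (ρ (π (conj c)))` — the holomorphic part realised by `ρ`, plus the complex
conjugate of the realisation of the holomorphic part of the conjugate family.  `ℂ`-linear. [cite: BorelWallach2000, VII 2.10 and VII 3.2]
[cite: VoisinHodgeI2002, §6.1.3 Cor. 6.12] -/
def realL (Γ : Level V) (hΓ : Γ.BelowConjThree) : towerLevel hHD hI hU h₃ hA Γ hΓ →ₗ[ℂ] ((adelicDatum L V).Adelic → (Fin 2 → ℂ)) :=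
  (ρ Γ hΓ).comp (holPart hHD hI hU h₃ hA Γ hΓ) +
    (conjFun L V).comp ((ρ Γ hΓ).comp ((holPart hHD hI hU h₃ hA Γ hΓ).comp (conjL hHD hI hU h₃ hA Γ hΓ)))

variable {ρ}

/-- Unfolding the level realisation. [cite: BorelWallach2000, VII 2.10] -/
theorem realL_apply {Γ : Level V} (hΓ : Γ.BelowConjThree) (c : towerLevel hHD hI hU h₃ hA Γ hΓ) :
    realL hHD hI hU h₃ hA ρ Γ hΓ c = ρ Γ hΓ (holPart hHD hI hU h₃ hA Γ hΓ c) +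
      conjFun L V (ρ Γ hΓ (holPart hHD hI hU h₃ hA Γ hΓ (conjL hHD hI hU h₃ hA Γ hΓ c))) := rfl

variable (ρ)

/-- **A levelwise holomorphic realisation system** (hypothesis structure of this file): (R1) `restrict` — compatibility with the change of level;
(R2) `translate` — compatibility of the re-indexing `translate g` with the finite-adelic right translation `rightRep g`; (R3) `mem` — values in the
holomorphic cotangent forms of the factor of record; (R4) `injective` — injectivity at every level.  The glue file of the joint desk instantiates it
with the harmonic pull-backs of the component classes. [cite: BorelWallach2000, VII 3.2 and XIII 1.2] [cite: Borel1997, §5.14] -/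
structure IsSystem : Prop where
  /-- (R1) `ρ_{Γ'} (restrictLevel a) = ρ_Γ a` for `Γ' ≤ Γ`. -/
  restrict : ∀ (Γ Γ' : Level V) (hle : Γ' ≤ Γ) (hΓ : Γ.BelowConjThree) (hΓ' : Γ'.BelowConjThree) (a : ↥(H10L hHD hI hU h₃ hA Γ hΓ)),
    ρ Γ' hΓ' ⟨restrictLevel hHD hI hU h₃ hA hle hΓ hΓ' a, restrictLevel_mem_H10L hHD hI hU h₃ hA hle hΓ hΓ' a.2⟩ = ρ Γ hΓ a
  /-- (R2) `ρ_{gΓg⁻¹} (translate g a) = R_g (ρ_Γ a)`. -/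
  translate : ∀ (Γ : Level V) (hΓ : Γ.BelowConjThree) (g : V.adelicFin) (a : ↥(H10L hHD hI hU h₃ hA Γ hΓ)),
    ρ (Γ.conj g hΓ) (hΓ.conj g) ⟨translate hHD hI hU h₃ hA hΓ g a, translate_mem_H10L hHD hI hU h₃ hA hΓ g a.2⟩ =
      rightRep L V g (ρ Γ hΓ a)
  /-- (R3) `ρ_Γ a ∈ holCotForms (archFactorOf F V)`. -/
  mem : ∀ (Γ : Level V) (hΓ : Γ.BelowConjThree) (a : ↥(H10L hHD hI hU h₃ hA Γ hΓ)), ρ Γ hΓ a ∈ holCotForms (archFactorOf L V)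
  /-- (R4) `ρ_Γ` is injective. -/
  injective : ∀ (Γ : Level V) (hΓ : Γ.BelowConjThree), Function.Injective (ρ Γ hΓ)

variable {ρ}

/-- **Over (R1) the level realisations are compatible with the transition maps of the tower.** [cite: BorelWallach2000, XIII 1.2] -/
theorem realL_restrictLevel (hρ : IsSystem hHD hI hU h₃ hA ρ) {Γ Γ' : Level V} (hle : Γ' ≤ Γ) (hΓ : Γ.BelowConjThree)
    (hΓ' : Γ'.BelowConjThree) (c : towerLevel hHD hI hU h₃ hA Γ hΓ) :
    realL hHD hI hU h₃ hA ρ Γ' hΓ' (restrictLevel hHD hI hU h₃ hA hle hΓ hΓ' c) = realL hHD hI hU h₃ hA ρ Γ hΓ c := by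
  simp only [realL_apply, holPart_restrictLevel, ← restrictLevel_conjL, hρ.restrict Γ Γ' hle hΓ hΓ']

/-- **THE REALISATION OF THE TOWER** `H = colim_K H_K → (U(V)(𝔸_{F⁺}) → ℂ²)`: the direct limit of the level realisations (well defined over (R1)).
[cite: BorelWallach2000, VII 3.2 and XIII 1.2] [cite: VoisinHodgeI2002, §7.1.1 Cor. 7.6] -/
def realT (hρ : IsSystem hHD hI hU h₃ hA ρ) : Tower hHD hI hU h₃ hA V →ₗ[ℂ] ((adelicDatum L V).Adelic → (Fin 2 → ℂ)) :=
  Module.DirectLimit.lift ℂ (TLvl V) (HK hHD hI hU h₃ hA V) (towerSystem hHD hI hU h₃ hA V)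
    (fun i ↦ realL hHD hI hU h₃ hA ρ i.1 i.2)
    (fun i j hij c ↦ realL_restrictLevel hHD hI hU h₃ hA hρ (TLvl.le_def.mp hij) i.2 j.2 c)

/-- **`realT ∘ ofLevel Γ = realL Γ`.** [cite: BorelWallach2000, XIII 1.2] -/
@[simp] theorem realT_ofLevel (hρ : IsSystem hHD hI hU h₃ hA ρ) (Γ : Level V) (hΓ : Γ.BelowConjThree)
    (c : towerLevel hHD hI hU h₃ hA Γ hΓ) :
    realT hHD hI hU h₃ hA hρ (ofLevel hHD hI hU h₃ hA Γ hΓ c) = realL hHD hI hU h₃ hA ρ Γ hΓ c :=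
  Module.DirectLimit.lift_of _ _ _

/-! ## §3 Values in `cohForms 𝔞₀`, equivariance, injectivity -/

/-- Over (R3) the level realisation is valued in `cohForms 𝔞₀ = holCotForms 𝔞₀ ⊔ conj (holCotForms 𝔞₀)`. [cite: BorelWallach2000, VII 2.10] -/
theorem realL_mem_cohForms (hρ : IsSystem hHD hI hU h₃ hA ρ) {Γ : Level V} (hΓ : Γ.BelowConjThree) (c : towerLevel hHD hI hU h₃ hA Γ hΓ) :
    realL hHD hI hU h₃ hA ρ Γ hΓ c ∈ cohForms (archFactorOf L V) :=
  Submodule.add_mem_sup (hρ.mem _ _ _) (Submodule.mem_map_of_mem (hρ.mem _ _ _))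

/-- **Over (R3) the realisation of the tower is valued in `cohForms 𝔞₀`.** [cite: BorelWallach2000, VII 2.10 and VII 3.2] -/
theorem realT_mem_cohForms (hρ : IsSystem hHD hI hU h₃ hA ρ) (x : Tower hHD hI hU h₃ hA V) :
    realT hHD hI hU h₃ hA hρ x ∈ cohForms (archFactorOf L V) := by
  obtain ⟨Γ, hΓ, c, rfl⟩ := exists_ofLevel hHD hI hU h₃ hA x
  rw [realT_ofLevel]
  exact realL_mem_cohForms hHD hI hU h₃ hA hρ hΓ c

/-- Over (R2) the level realisations intertwine `translate g` with `rightRep g` (`conjFun` commutes with `rightRep`, ★ `conjFun_rightRep`; `conjL` with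
`translate`, ★ `translate_conjL`). [cite: BorelWallach2000, XIII 1.2] -/
theorem realL_translate (hρ : IsSystem hHD hI hU h₃ hA ρ) {Γ : Level V} (hΓ : Γ.BelowConjThree) (g : V.adelicFin)
    (c : towerLevel hHD hI hU h₃ hA Γ hΓ) :
    realL hHD hI hU h₃ hA ρ (Γ.conj g hΓ) (hΓ.conj g) (translate hHD hI hU h₃ hA hΓ g c) = rightRep L V g (realL hHD hI hU h₃ hA ρ Γ hΓ c) := by
  simp only [realL_apply, holPart_translate, ← translate_conjL, hρ.translate Γ hΓ g, map_add, conjFun_rightRep]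

/-- **Over (R2) the realisation of the tower intertwines the Hecke action `act g` with the right translation `rightRep g`.**
[cite: BorelWallach2000, XIII 1.2] -/
theorem realT_act (hρ : IsSystem hHD hI hU h₃ hA ρ) (g : V.adelicFin) (x : Tower hHD hI hU h₃ hA V) :
    realT hHD hI hU h₃ hA hρ (act hHD hI hU h₃ hA g x) = rightRep L V g (realT hHD hI hU h₃ hA hρ x) := by
  obtain ⟨Γ, hΓ, c, rfl⟩ := exists_ofLevel hHD hI hU h₃ hA x
  rw [act_ofLevel, realT_ofLevel, realT_ofLevel, realL_translate hHD hI hU h₃ hA hρ]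

/-- **Over (R3)+(R4) the level realisation is INJECTIVE**: the two summands of `realL c` lie in the DISJOINT Hodge types (★
`disjoint_holCotForms_map_conjFun`), so both vanish; hence `π c = 0 = π (conj c)` and `c = π c + conj (π (conj c)) = 0`.
[cite: BorelWallach2000, VII 2.10] [cite: VoisinHodgeI2002, §6.1.3 Cor. 6.12] -/
theorem realL_injective (hρ : IsSystem hHD hI hU h₃ hA ρ) {Γ : Level V} (hΓ : Γ.BelowConjThree) :
    Function.Injective (realL hHD hI hU h₃ hA ρ Γ hΓ) := by
  refine (injective_iff_map_eq_zero _).mpr fun c hc ↦ ?_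
  rw [realL_apply] at hc
  have h4' : Function.Injective (ρ Γ hΓ) := hρ.injective Γ hΓ
  -- `ρ (π c) = - conj (ρ (π (conj c)))` lies in both Hodge types, hence vanishes
  have hmem : conjFun L V (ρ Γ hΓ (holPart hHD hI hU h₃ hA Γ hΓ (conjL hHD hI hU h₃ hA Γ hΓ c))) ∈
      (holCotForms (archFactorOf L V)).map (conjFun L V) :=
    Submodule.mem_map_of_mem (hρ.mem _ _ _)
  have hρa : ρ Γ hΓ (holPart hHD hI hU h₃ hA Γ hΓ c) =
      -conjFun L V (ρ Γ hΓ (holPart hHD hI hU h₃ hA Γ hΓ (conjL hHD hI hU h₃ hA Γ hΓ c))) :=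
    eq_neg_of_add_eq_zero_left hc
  have ha0 : ρ Γ hΓ (holPart hHD hI hU h₃ hA Γ hΓ c) = 0 :=
    (Submodule.disjoint_def.mp (disjoint_holCotForms_map_conjFun (archFactorOf L V))) _ (hρ.mem _ _ _)
      (by rw [hρa]; exact Submodule.neg_mem _ hmem)
  have hb0 : ρ Γ hΓ (holPart hHD hI hU h₃ hA Γ hΓ (conjL hHD hI hU h₃ hA Γ hΓ c)) = 0 := by
    rw [ha0, zero_add] at hc
    rw [← conjFun_conjFun L V (ρ Γ hΓ (holPart hHD hI hU h₃ hA Γ hΓ (conjL hHD hI hU h₃ hA Γ hΓ c))), hc, map_zero]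
  -- so both holomorphic parts vanish, and with them the family
  have ha' : holPart hHD hI hU h₃ hA Γ hΓ c = 0 := h4' (ha0.trans (map_zero (ρ Γ hΓ)).symm)
  have hb' : holPart hHD hI hU h₃ hA Γ hΓ (conjL hHD hI hU h₃ hA Γ hΓ c) = 0 := h4' (hb0.trans (map_zero (ρ Γ hΓ)).symm)
  have h10 : projL hHD hI hU h₃ hA Γ hΓ c = 0 := by rw [← coe_holPart, ha', Submodule.coe_zero]
  have h01 : projL hHD hI hU h₃ hA Γ hΓ (conjL hHD hI hU h₃ hA Γ hΓ c) = 0 := by rw [← coe_holPart, hb', Submodule.coe_zero]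
  calc c = projL hHD hI hU h₃ hA Γ hΓ c + conjL hHD hI hU h₃ hA Γ hΓ (projL hHD hI hU h₃ hA Γ hΓ (conjL hHD hI hU h₃ hA Γ hΓ c)) :=
      eq_projL_add_conjL_projL_conjL hHD hI hU h₃ hA c
    _ = 0 := by rw [h10, h01, map_zero, add_zero]

/-- **Over (R3)+(R4) THE REALISATION OF THE TOWER IS INJECTIVE** (every vector comes from some level; no injectivity of the transition maps is used).
[cite: VoisinHodgeI2002, §7.1.1 Cor. 7.6] [cite: BorelWallach2000, VII 3.2] -/
theorem realT_injective (hρ : IsSystem hHD hI hU h₃ hA ρ) :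
    Function.Injective (realT hHD hI hU h₃ hA hρ (V := V)) := by
  refine (injective_iff_map_eq_zero _).mpr fun x hx ↦ ?_
  obtain ⟨Γ, hΓ, c, rfl⟩ := exists_ofLevel hHD hI hU h₃ hA x
  rw [realT_ofLevel] at hx
  rw [(injective_iff_map_eq_zero _).mp (realL_injective hHD hI hU h₃ hA hρ hΓ) c hx, map_zero]

/-! ## §4 The packaged statement -/

/-- **THE MATSUSHIMA–HODGE REALISATION OF THE TOWER, from a levelwise holomorphic realisation system**: given `ρ` with (R1)–(R4) there is an INJECTIVE
`ℂ`-linear map `r : H = colim_K H¹(X_K(ℂ); ℂ) → (U(V)(𝔸_{F⁺}) → ℂ²)` with values in `cohForms (archFactorOf F V)` intertwining binder-1's Hecke action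
`towerRep` with the finite-adelic right translation `rightRep F V` — the common body of P2's `StubU1RealisationAt` and P3's `StubS1HodgeMatsushimaDecAt`
modulo `rhoB τ' = towerRep` (★ `ofModule'_tower_eq_towerRep`). [cite: BorelWallach2000, VII 3.2, VII 3.6, XIII 1.2] [cite: VoisinHodgeI2002, §7.1.1 Cor. 7.6] -/
theorem exists_realisation_of_system (ρ : ∀ (Γ : Level V) (hΓ : Γ.BelowConjThree),
      ↥(H10L hHD hI hU h₃ hA Γ hΓ) →ₗ[ℂ] ((adelicDatum L V).Adelic → (Fin 2 → ℂ)))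
    (hρ : IsSystem hHD hI hU h₃ hA ρ) :
    ∃ r : Tower hHD hI hU h₃ hA V →ₗ[ℂ] ((adelicDatum L V).Adelic → (Fin 2 → ℂ)),
      Function.Injective r ∧ (∀ x, r x ∈ cohForms (archFactorOf L V)) ∧
        ∀ (g : V.adelicFin) (x : Tower hHD hI hU h₃ hA V), r (towerRep hHD hI hU h₃ hA V g x) = rightRep L V g (r x) :=
  ⟨realT hHD hI hU h₃ hA hρ, realT_injective hHD hI hU h₃ hA hρ, realT_mem_cohForms hHD hI hU h₃ hA hρ, realT_act hHD hI hU h₃ hA hρ⟩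

end System

end Summit.HodgeConjecture.HodgeConjecture.Cruxes.H413.TowerRealisation

end
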